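import Mathlib
import HarnessLib
import Summits.HubbardSuperconductivity.HubbardSuperconductivity.Theorems.KLProgrammeKLRegimeWickReplicas
import Literature.MathematicalPhysics.QuantumLattice.GrassmannLaplacianTreeExpansion

/-!
# Route `KLProgramme` — ENGINE child (E2-v9): the Wick moments ARE the convolution moments of the OFF-DIAGONAL replica covariance
# (E2-WICK-ROADMAP §5 (i): the input of the ursell/tree half, in `GrassmannLaplacianTreeExpansion`'s vocabulary; cell gate-hubbard-kl, seat p1 g8)

Sequel to p489336 (`…WickReplicas`: `wickMoment_eq_collapse`).  In the tree's cumulant vocabulary (`convMoment R C M Q = e^{Δ_C}(∏_{a∈Q} M a)`,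
cluster map `Prod.fst` on the replica labels `Fin n × Γ`): with `M a := replicaCopy_a (w a)` (the Wick vertices placed in replica `a`) and
`M′ a := replicaCopy_a (e^{−Δ_{D+C}} w a)` (the Wick-ORDERED vertices), for EVERY subset `Q` of replicas

  `e^{Δ_{allCov D}} (convMoment (allCov C) M′ Q) = convMoment (offCov (D + C)) M Q`      (`evenGaussConv_allCov_convMoment_eq`)

— smearing the plain `C`-moments of the Wick-ordered replicas by the soft covariance gives the moments of the Wick replicas for the covariance
`offCov (D+C)`: inter-replica lines only, weight `D + C` each.  Consequently the tree's BBF/ursell theorems (`convMoment_eq_sum_treeOp`,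
`ursellOf_convMoment_eq_treeOp`, with `cl = Prod.fst`, `hM` = `replicaCopy_mem_fieldSubalgebra`) apply VERBATIM to the right-hand side
(`ursellOf_wickMoment_eq_treeOp`): the Ursell functions of the Wick moments are tree expansions in the inter-replica lines of `D + C`.
(The step's Wick CUMULANT `e^{Δ_D}𝓔ᵀ_C` is the `C`-connected, `D`-decorated refinement of this — roadmap §5 (i), second half.)

Proved; no definitions; nothing about the model is asserted.
-/

noncomputable section

namespace Summit.HubbardSuperconductivity.HubbardSuperconductivity.Theorems.KLRegimeWick

set_option linter.dupNamespace false -- summit = problem name (single-conjunct summit), D-0017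

open Literature.MathematicalPhysics.QuantumLattice GrassmannAlgebra Finset Matrix
open Literature.Probability.LatticeModels

section Replica

variable (R : Type*) [CommRing R] [Algebra ℚ R] {Γ : Type*} [Fintype Γ] [DecidableEq Γ] {n : ℕ}

omit [DecidableEq Γ] in
/-- The Wick-ordered even element `e^{−Δ_{C'}} w` as an element of `evenPart`. -/
theorem gaussConv_neg_mem_evenPart (C' : Matrix Γ Γ R) (w : evenPart R Γ) : gaussConv R (-C') (w : GrassmannAlgebra R Γ) ∈ evenPart R Γ :=
  (mem_evenPart_iff).2 (gaussConv_mem_evenOdd R _ ((mem_evenPart_iff).1 w.2))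

/-- **The diagonal blocks undo the Wick ordering on every SUB-product**: for even `w_a` and any set `Q` of replicas,
`e^{Δ_{diagCov C'}} (∏_{a∈Q} copy_a (e^{−Δ_{C'}} w_a)) = ∏_{a∈Q} copy_a w_a`. -/
theorem gaussConv_diagCov_prod_replicaCopyEven_wick (C' : Matrix Γ Γ R) (w : Fin n → evenPart R Γ) (Q : Finset (Fin n)) :
    gaussConv R (diagCov R C') ((∏ a ∈ Q, replicaCopyEven R a ⟨gaussConv R (-C') (w a), gaussConv_neg_mem_evenPart R C' (w a)⟩ :
        evenPart R (Fin n × Γ)) : GrassmannAlgebra R (Fin n × Γ)) =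
      ((∏ a ∈ Q, replicaCopyEven R a (w a) : evenPart R (Fin n × Γ)) : GrassmannAlgebra R (Fin n × Γ)) := by
  set w' : Fin n → evenPart R Γ := fun a => ⟨gaussConv R (-C') (w a), gaussConv_neg_mem_evenPart R C' (w a)⟩ with hw'
  -- peel the diagonal blocks one by one over ALL replicas; blocks outside `Q` act trivially
  suffices h : ∀ T : Finset (Fin n),
      gaussConv R (∑ a ∈ T, blkCov R C' a a) ((∏ a ∈ Q, replicaCopyEven R a (w' a) : evenPart R (Fin n × Γ)) : GrassmannAlgebra R _) =
        ((∏ a ∈ Q, replicaCopyEven R a (if a ∈ T then w a else w' a) : evenPart R (Fin n × Γ)) : GrassmannAlgebra R _) by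
    rw [diagCov_eq_sum, h Finset.univ]
    simp
  intro T
  induction T using Finset.induction_on with
  | empty => simp
  | insert a T haT ih =>
    rw [Finset.sum_insert haT, gaussConv_add_apply, ih, gaussConv_blkCov_prod_replicaCopyEven]
    congr 1
    refine Finset.prod_congr rfl fun b _ => ?_
    by_cases hb : b = a
    · subst hb
      rw [if_pos rfl, if_neg haT, if_pos (Finset.mem_insert_self b T)]
      congr 1
      exact Subtype.ext (gaussConv_gaussConv_neg_apply R C' (w b))
    · rw [if_neg hb]
      by_cases hbT : b ∈ T
      · rw [if_pos hbT, if_pos (Finset.mem_insert_of_mem hbT)]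
      · rw [if_neg hbT, if_neg (fun h => (Finset.mem_insert.1 h).elim hb hbT)]

/-- **`evenGaussConv_allCov_convMoment_eq` — the Wick moments are the convolution moments of the off-diagonal replica covariance**:
`e^{Δ_{allCov D}} (convMoment (allCov C) M′ Q) = convMoment (offCov (D + C)) M Q` for every set `Q` of replicas. -/
theorem evenGaussConv_allCov_convMoment_eq (C D : Matrix Γ Γ R) (w : Fin n → evenPart R Γ) (Q : Finset (Fin n)) :
    evenGaussConv R (allCov R D)
        (convMoment R (allCov R C) (fun a => replicaCopyEven R a ⟨gaussConv R (-(D + C)) (w a), gaussConv_neg_mem_evenPart R _ (w a)⟩) Q) =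
      convMoment R (offCov R (D + C)) (fun a => replicaCopyEven R a (w a)) Q := by
  refine Subtype.ext ?_
  rw [coe_evenGaussConv, convMoment, coe_evenGaussConv, convMoment, coe_evenGaussConv, ← gaussConv_add_apply,
    show allCov R (n := n) D + allCov R C = allCov R (D + C) from by ext p q; simp [allCov],
    allCov_eq_diag_add_off, add_comm (diagCov R (D + C)), gaussConv_add_apply, gaussConv_diagCov_prod_replicaCopyEven_wick]

omit [Algebra ℚ R] in
/-- The Wick replicas are cluster-supported (hypothesis `hM` of the tree's tree-expansion theorems, with `cl = Prod.fst`). -/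
theorem coe_replicaCopyEven_mem_cluster (w : Fin n → evenPart R Γ) (a : Fin n) :
    ((replicaCopyEven R a (w a) : evenPart R (Fin n × Γ)) : GrassmannAlgebra R (Fin n × Γ)) ∈
      fieldSubalgebra R ((Prod.fst : Fin n × Γ → Fin n) ⁻¹' {a}) :=
  replicaCopy_mem_fieldSubalgebra R a _

/-- **The Ursell functions of the Wick moments are BBF tree expansions in the inter-replica lines of `D + C`**: the tree's
`ursellOf_convMoment_eq_treeOp` applied to the off-diagonal replica covariance and the Wick replicas. -/
theorem ursellOf_wickMoment_eq_treeOp (C D : Matrix Γ Γ R) (w : Fin n → evenPart R Γ) (W : Finset (Fin n)) {v : Fin n}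
    (hv : v ∈ W) :
    ursellOf (convMoment R (offCov R (D + C)) (fun a => replicaCopyEven R a (w a))) W =
      onEven R (offCov R (D + C)) (Prod.fst : Fin n × Γ → Fin n) (treeOp R (offCov R (D + C)) Prod.fst v W)
        (∏ a ∈ W, replicaCopyEven R a (w a)) :=
  ursellOf_convMoment_eq_treeOp R (offCov R (D + C)) Prod.fst (coe_replicaCopyEven_mem_cluster R w) W hv

end Replica

end Summit.HubbardSuperconductivity.HubbardSuperconductivity.Theorems.KLRegimeWick

end
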